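import Literature.Computability.Complexity.CodeFPListKit
import Literature.Computability.Complexity.CodeFPTableKit
import HarnessLib

/-!
# Typed polynomial time on codes: folds and iterations with a step-indexed size invariant

Trunk `CplxCore`, sequel of `CodeFP.lean` (the fold combinator `CodeFP.foldl`, whose one hypothesis is a polynomial
bound on the accumulator code along every prefix of every item list) and `CodeFPListKit.lean`
(`foldl_units_eq_iterate`). Loops of arithmetic programs (square-and-multiply, walks that add a bounded log per step)
keep an INVARIANT indexed by the number of steps taken — "after `j` steps the label is short and the position is at
most `2^j · H`" — from which the accumulator bound is linear in `j`. This file packages that pattern once, in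
pointwise form (context `s : σ`, the item list / the unary step count computed from the context):

* `foldl_inv_holds`, `iterate_inv_holds` — an invariant `Inv s j b` preserved by the step holds after any `j` steps;
* `foldlInv` — `s ↦ (l s).foldl (step s) (init s)` is computed on codes when the step and the initial value are, and
  the invariant bounds the accumulator code by a polynomial in `|code s| + j`;
* `iterateInv` — the same for `s ↦ (F s)^[k s] (init s)` with `k` computed in unary.

## References

* S. Arora, B. Barak, *Computational Complexity: A Modern Approach*, CUP 2009, §1.3 (closure of polynomial time
  under polynomially bounded loops). [AroraBarak2009]
-/

namespace Literature.Computability.Complexity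

namespace CodeFP

open _root_.Computability Polynomial Brick

variable {α β σ : Type} {eα : α → List Bool} {eβ : β → List Bool} {eσ : σ → List Bool}

/-- **A step-indexed invariant holds along a fold**: if `Inv s 0 (init s)` and every step takes `Inv s j` to
`Inv s (j + 1)`, then after folding a list of length `j` the accumulator satisfies `Inv s j`. [folklore] -/
theorem foldl_inv_holds {step : σ → α → β → β} {init : σ → β} (Inv : σ → ℕ → β → Prop)
    (h0 : ∀ s, Inv s 0 (init s)) (hS : ∀ s j a b, Inv s j b → Inv s (j + 1) (step s a b)) (s : σ) (l : List α) :
    Inv s l.length (l.foldl (fun b a => step s a b) (init s)) := by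
  induction l using List.reverseRecOn with
  | nil => exact h0 s
  | append_singleton l a ih =>
    rw [List.foldl_append, List.foldl_cons, List.foldl_nil, List.length_append, List.length_singleton]
    exact hS s _ a _ ih

/-- **A step-indexed invariant holds along an iteration.** [folklore] -/
theorem iterate_inv_holds {F : σ → β → β} {init : σ → β} (Inv : σ → ℕ → β → Prop)
    (h0 : ∀ s, Inv s 0 (init s)) (hS : ∀ s j b, Inv s j b → Inv s (j + 1) (F s b)) (s : σ) (k : ℕ) :
    Inv s k ((F s)^[k] (init s)) := by
  induction k with
  | zero => exact h0 s
  | succ k ih => rw [Function.iterate_succ_apply']; exact hS s k _ ih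

/-- **Folds with a step-indexed size invariant** (pointwise form): for a step and an initial value computed on
codes, an item list computed from the context, and an invariant `Inv s j b` preserved by the step under which the
accumulator code is at most `Q(|code s| + j)`, the fold `s ↦ (l s).foldl (step s) (init s)` is computed on codes.
[cite: AroraBarak2009, §1.3] -/
theorem foldlInv {step : σ → α → β → β} {init : σ → β} {l : σ → List α} (Inv : σ → ℕ → β → Prop)
    (hstep : CodeFP (pairE eσ (pairE eα eβ)) eβ (fun t => step t.1 t.2.1 t.2.2)) (hinit : CodeFP eσ eβ init)
    (hl : CodeFP eσ (rawE eα) l)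
    (h0 : ∀ s, Inv s 0 (init s)) (hS : ∀ s j a b, Inv s j b → Inv s (j + 1) (step s a b))
    (Q : Polynomial ℕ) (hlen : ∀ s j b, Inv s j b → (eβ b).length ≤ Q.eval ((eσ s).length + j)) :
    CodeFP eσ eβ (fun s => (l s).foldl (fun b a => step s a b) (init s)) := by
  have h := foldl hstep hinit Q (fun s l₁ l₂ => by
    refine (hlen s _ _ (foldl_inv_holds Inv h0 hS s l₁)).trans (TM2Iter.eval_mono Q ?_)
    rw [length_pairE_mk]
    have := length_le_length_rawE eα (l₁ ++ l₂)
    rw [List.length_append] at this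
    omega)
  exact (h.comp ((CodeFP.id eσ).pair hl) :)

/-- **Iterations with a step-indexed size invariant** (pointwise form, the count computed in unary):
`s ↦ (F s)^[k s] (init s)` is computed on codes. [cite: AroraBarak2009, §1.3] -/
theorem iterateInv {F : σ → β → β} {init : σ → β} {k : σ → ℕ} (Inv : σ → ℕ → β → Prop)
    (hF : CodeFP (pairE eσ eβ) eβ (fun t => F t.1 t.2)) (hinit : CodeFP eσ eβ init) (hk : CodeFP eσ unE k)
    (h0 : ∀ s, Inv s 0 (init s)) (hS : ∀ s j b, Inv s j b → Inv s (j + 1) (F s b))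
    (Q : Polynomial ℕ) (hlen : ∀ s j b, Inv s j b → (eβ b).length ≤ Q.eval ((eσ s).length + j)) :
    CodeFP eσ eβ (fun s => (F s)^[k s] (init s)) := by
  have hstep : CodeFP (pairE eσ (pairE unitE eβ)) eβ (fun t => F t.1 t.2.2) :=
    (hF.comp ((fst _ _).pair (snd _ _).snd') :)
  have h := foldlInv (step := fun s (_ : Unit) b => F s b) (l := fun s => List.replicate (k s) ()) Inv hstep hinit
    (replicateUnit.comp hk) h0 (fun s j _ b hb => hS s j b hb) Q hlen
  exact h.congr fun s => foldl_units_eq_iterate (F s) (k s) (init s)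

end CodeFP

end Literature.Computability.Complexity
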